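import Summits.ResolutionOfSingularities.ResolutionOfSingularities.Theorems.NearCutWalls2
import HarnessLib

/-!
# NearCutArcs — decomp-res node «NearCut» (lens-3 g22, critic row 170), tree file 9/10 of the node

Content VERBATIM from the decomp-res lens-3 g22 node `HOME/decomp-res-lens-3/g22/NearCut.lean` (pin 52e91527; HOME =
run/shared/lean/pub/decomp-res); critic row 170
BOOKED 0·0; landing orders INBOX :715 / :727 — provenance, critic text and the lens header in full in the first file
of the node, `NearCutForms`.  Namespace
`…Theorems.NearCut`; `--supports stmt-ResolutionOfSingularities-31770`; linear import chain in the lens's order.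

## This file

§N5d ARC SHEDDING (kernel: `ordN`, `wallSum_drop`, the monovariant **`arc_shedding`** on formal arcs) and BRANCH
SELECTION (`BranchSelection` — the named classical LIBRARY target: curve selection / arc lifting along a
point-blowup chain — a `Prop` defined here, used only as a hypothesis) with `chainShedding_of_branchSelection`
(sections `ArcShedding`, `Branch`).

[WRITER NOTE (decomp-res writer g10): file split only (tree files ≤ 400 lines); namespace blocks, sections, section
variables, `open` lines and every declaration
exactly as in the lens; the three deprecated `Finsupp.degree_add` occurrences read `map_add` (definitionally the same lemma).]

(Sources: cossart2020 (Cossart–Jannsen–Saito LNM 2270: Thm 5.40 p. 85, Defs 5.38/5.39 pp. 84–85, Thm 5.28 p. 72, Thm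
5.35 / Cor 5.37); HauserPerlega2024 (Prop. 3 p. 791); Hauser2010Kangaroo (arXiv:0811.4151); Moh1987;
CossartPiltant2008 §2; Giraud1975; Hironaka1964.)
-/

noncomputable section

open MvPolynomial Finset
open Literature.AlgebraicGeometry.Resolution
open Literature.AlgebraicGeometry.Resolution.Hauser2010
open Literature.AlgebraicGeometry.Resolution.PointBlowup
open Summit.ResolutionOfSingularities.ResolutionOfSingularities.Theses
open Summit.ResolutionOfSingularities.ResolutionOfSingularities.Theorems.TightDefectClasses
open Summit.ResolutionOfSingularities.ResolutionOfSingularities.Theorems.TightDefectStrongWalks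
open Summit.ResolutionOfSingularities.ResolutionOfSingularities.Theorems.ItineraryCutClasses
open Summit.ResolutionOfSingularities.ResolutionOfSingularities.Theorems.BoundaryLedger
open Summit.ResolutionOfSingularities.ResolutionOfSingularities.Theorems.ProximityCut
open Summit.ResolutionOfSingularities.ResolutionOfSingularities.Theorems.ConeCutAxisLaw
open Literature.AlgebraicGeometry.Resolution.WeightedBlowup
open Literature.Barriers.ResolutionOfSingularities
open Summit.ResolutionOfSingularities.ResolutionOfSingularities.Theorems.FloorCut
open Summit.ResolutionOfSingularities.ResolutionOfSingularities.Theorems.ConeCut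
open Summit.ResolutionOfSingularities.ResolutionOfSingularities.Theorems.ExitLaw (fin3_cases eq_of_le_of_degree_le)
open Summit.ResolutionOfSingularities.ResolutionOfSingularities.Theorems.ShadeCut
open Summit.ResolutionOfSingularities.ResolutionOfSingularities.Theorems.TightCut
open Summit.ResolutionOfSingularities.ResolutionOfSingularities.Theorems.HoleCut

namespace Summit.ResolutionOfSingularities.ResolutionOfSingularities.Theorems.NearCut

section ArcShedding

/-! ### §N5d ARC SHEDDING (kernel) and BRANCH SELECTION (library target): the monovariant half of the shedding argument
is PROVED for compatible families of formal arcs `γ⁽ⁿ⁾ ∈ (τ L⟦τ⟧)³` through the centres; what remains of `ChainShedding`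
is the classical CURVE-SELECTION / ARC-LIFTING fact `BranchSelection` (a non-isolated point of the order-`s` locus lies on
a formal branch, and along a point-blowup chain whose order-`s` loci are never isolated one branch is followed for ever —
decomposition into components, finiteness of branches, Cohen structure of smooth curve germs, König), and
`chainShedding_of_branchSelection : BranchSelection → ChainShedding` is PROVED. -/

/-- The natural-number order of a power series (junk value `0` at the zero series). -/
noncomputable def ordN {L : Type*} [Semiring L] (x : PowerSeries L) : ℕ := x.order.toNat

/-- `ordN_coe`: Auxiliary step of this node's calculus, VERBATIM from the lens file (see the module docstring); the
statement is its type. [folklore] -/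
theorem ordN_coe {L : Type*} [Semiring L] {x : PowerSeries L} (hx : x ≠ 0) :
    (ordN x : ℕ∞) = x.order := by
  unfold ordN
  exact ENat.coe_toNat_eq_self.mpr (by simpa [PowerSeries.order_eq_top] using hx)

/-- `ordN_mul`: Auxiliary step of this node's calculus, VERBATIM from the lens file (see the module docstring); the
statement is its type. [folklore] -/
theorem ordN_mul {L : Type*} [Field L] {x y : PowerSeries L} (hx : x ≠ 0) (hy : y ≠ 0) :
    ordN (x * y) = ordN x + ordN y := by
  have hxy : x * y ≠ 0 := mul_ne_zero hx hy
  have h := PowerSeries.order_mul x y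
  rw [← ordN_coe hx, ← ordN_coe hy, ← ordN_coe hxy] at h
  exact_mod_cast h

/-- `one_le_ordN`: Auxiliary step of this node's calculus, VERBATIM from the lens file (see the module docstring);
the statement is its type. [folklore] -/
theorem one_le_ordN {L : Type*} [Semiring L] {x : PowerSeries L} (hx : x ≠ 0)
    (h0 : PowerSeries.constantCoeff x = 0) : 1 ≤ ordN x := by
  have h1 : ((1 : ℕ) : ℕ∞) ≤ x.order := PowerSeries.nat_le_order x 1 (fun i hi => by
    have hi0 : i = 0 := by omega
    subst hi0
    simpa [PowerSeries.coeff_zero_eq_constantCoeff_apply] using h0)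
  rw [← ordN_coe hx] at h1
  exact_mod_cast h1

/-- The arithmetic of one blow-up step of the wall monovariant
`Ψ = Σ_{walls} (order of the wall coordinate along the arc)`: it drops by at least the
multiplicity `m ≥ 1` of the arc (exceptional wall contributes `m`, each kept wall loses `m`,
non-kept walls leave the sum; two walls at both stages). [folklore] -/
theorem wallSum_drop (jj : Fin 3) (w w' : Fin 3 → Prop) [DecidablePred w] [DecidablePred w']
    (a a' : Fin 3 → ℕ) (m : ℕ) (haj' : a' jj = m) (hexc : w' jj)
    (hkept : ∀ c, w' c → c ≠ jj → w c ∧ a c = m + a' c) (hge : ∀ c, w c → m ≤ a c)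
    (htwo : ∃ c₁ c₂, c₁ ≠ c₂ ∧ w c₁ ∧ w c₂) (htwo' : ∃ c₁ c₂, c₁ ≠ c₂ ∧ w' c₁ ∧ w' c₂) :
    (∑ c, if w' c then a' c else 0) + m ≤ ∑ c, if w c then a c else 0 := by
  have e0' : (∑ c, if w' c then a' c else 0) = ∑ c ∈ Finset.univ.filter (fun c => w' c), a' c := by
    rw [Finset.sum_filter]
  have e0 : (∑ c, if w c then a c else 0) = ∑ c ∈ Finset.univ.filter (fun c => w c), a c := by
    rw [Finset.sum_filter]
  rw [e0', e0]
  set S' := Finset.univ.filter (fun c => w' c) with hS'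
  set S := Finset.univ.filter (fun c => w c) with hS
  set T := S'.erase jj with hTdef
  have hjS' : jj ∈ S' := by simp [hS', hexc]
  have hT : ∀ c ∈ T, w c ∧ a c = m + a' c := by
    intro c hc
    rw [hTdef, Finset.mem_erase] at hc
    exact hkept c (by simpa [hS'] using hc.2) hc.1
  have hTS : T ⊆ S := fun c hc => by simpa [hS] using (hT c hc).1
  have e1 : ∑ c ∈ S', a' c = m + ∑ c ∈ T, a' c := by
    rw [← Finset.add_sum_erase S' a' hjS', haj']
  have e2 : ∑ c ∈ T, a c = ∑ c ∈ T, a' c + T.card * m := by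
    rw [← smul_eq_mul, ← Finset.sum_const, ← Finset.sum_add_distrib]
    exact Finset.sum_congr rfl (fun c hc => by rw [(hT c hc).2]; ring)
  set P := T.card * m with hPdef
  have e3 : ∑ c ∈ S, a c = (∑ c ∈ S \ T, a c) + ∑ c ∈ T, a c := (Finset.sum_sdiff hTS).symm
  obtain ⟨c₁, c₂, hne', h1', h2'⟩ := htwo'
  have hc1 : c₁ ∈ S' := by simpa [hS'] using h1'
  have hc2 : c₂ ∈ S' := by simpa [hS'] using h2'
  have hTpos : 1 ≤ T.card := by
    rcases eq_or_ne c₁ jj with h | h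
    · exact Finset.card_pos.mpr ⟨c₂, Finset.mem_erase.mpr ⟨fun h2 => hne' (h.trans h2.symm), hc2⟩⟩
    · exact Finset.card_pos.mpr ⟨c₁, Finset.mem_erase.mpr ⟨h, hc1⟩⟩
  obtain ⟨d₁, d₂, hne, h1, h2⟩ := htwo
  have hd1 : d₁ ∈ S := by simpa [hS] using h1
  have hd2 : d₂ ∈ S := by simpa [hS] using h2
  by_cases hboth : d₁ ∈ T ∧ d₂ ∈ T
  · have h2T : 2 ≤ T.card := Finset.one_lt_card.mpr ⟨d₁, hboth.1, d₂, hboth.2, hne⟩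
    have hP : 2 * m ≤ P := by rw [hPdef]; exact Nat.mul_le_mul_right m h2T
    rw [e1, e3, e2]
    omega
  · obtain ⟨d, hdS, hdT⟩ : ∃ d, d ∈ S ∧ d ∉ T := by
      by_cases h : d₁ ∈ T
      · exact ⟨d₂, hd2, fun h' => hboth ⟨h, h'⟩⟩
      · exact ⟨d₁, hd1, h⟩
    have hdm : m ≤ ∑ c ∈ S \ T, a c :=
      le_trans (hge d (by simpa [hS] using hdS))
        (Finset.single_le_sum (f := a) (fun c _ => Nat.zero_le _) (Finset.mem_sdiff.mpr ⟨hdS, hdT⟩))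
    have hP : 1 * m ≤ P := by rw [hPdef]; exact Nat.mul_le_mul_right m hTpos
    rw [e1, e3, e2]
    omega

/-- ARC SHEDDING (kernel).  A compatible family of formal arcs `γ⁽ⁿ⁾ ∈ (τL⟦τ⟧)³` through the
centres of a point-blowup chain (`γ⁽ⁿ⁾ = σₙ ∘ γ⁽ⁿ⁺¹⁾` in the chart `y_j = y'_j, y_i = y'_j (y'_i + b_i)`)
cannot avoid the walls forever when the exceptional plane is always a wall, kept walls are
untranslated, and every stage has two walls: the monovariant `Σ_{walls} ord(y_c ∘ γ⁽ⁿ⁾)` would drop by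
the multiplicity `ord(y_{jₙ} ∘ γ⁽ⁿ⁾) ≥ 1` at every step. [folklore] -/
theorem arc_shedding {L : Type*} [Field L] (γ : ℕ → Fin 3 → PowerSeries L) (j : ℕ → Fin 3)
    (b : ℕ → Fin 3 → L) (wall : ℕ → Fin 3 → Prop)
    (h0 : ∀ n i, PowerSeries.constantCoeff (γ n i) = 0)
    (hj : ∀ n, γ n (j n) = γ (n + 1) (j n))
    (hi : ∀ n i, i ≠ j n → γ n i = γ n (j n) * (γ (n + 1) i + PowerSeries.C (b n i)))
    (hne : ∀ n c, wall n c → γ n c ≠ 0)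
    (htwo : ∀ n, ∃ c₁ c₂, c₁ ≠ c₂ ∧ wall n c₁ ∧ wall n c₂)
    (hexc : ∀ n, wall (n + 1) (j n))
    (hkept : ∀ n c, wall (n + 1) c → c ≠ j n → wall n c ∧ b n c = 0) : False := by
  classical
  have hjne : ∀ n, γ n (j n) ≠ 0 := fun n => by
    rw [hj n]; exact hne (n + 1) (j n) (hexc n)
  have hm1 : ∀ n, 1 ≤ ordN (γ n (j n)) := fun n => one_le_ordN (hjne n) (h0 n (j n))
  have hF1 : ∀ n, ordN (γ (n + 1) (j n)) = ordN (γ n (j n)) := fun n => by rw [← hj n]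
  have hF2 : ∀ n c, wall (n + 1) c → c ≠ j n →
      wall n c ∧ ordN (γ n c) = ordN (γ n (j n)) + ordN (γ (n + 1) c) := by
    intro n c hw hc
    obtain ⟨hwn, hb⟩ := hkept n c hw hc
    refine ⟨hwn, ?_⟩
    have e := hi n c hc
    rw [hb, map_zero, add_zero] at e
    rw [e]
    exact ordN_mul (hjne n) (hne (n + 1) c hw)
  have hF3 : ∀ n c, wall n c → ordN (γ n (j n)) ≤ ordN (γ n c) := by
    intro n c hw
    by_cases hc : c = j n
    · rw [hc]
    · have e := hi n c hc
      have hγ := hne n c hw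
      have hu : γ (n + 1) c + PowerSeries.C (b n c) ≠ 0 := by
        intro hz; apply hγ; rw [e, hz, mul_zero]
      rw [e, ordN_mul (hjne n) hu]
      exact Nat.le_add_right _ _
  obtain ⟨Ψ, hΨ⟩ : ∃ Ψ : ℕ → ℕ, ∀ n, Ψ n = ∑ c, if wall n c then ordN (γ n c) else 0 :=
    ⟨_, fun n => rfl⟩
  have hdrop : ∀ n, Ψ (n + 1) + 1 ≤ Ψ n := by
    intro n
    have h := wallSum_drop (j n) (wall n) (wall (n + 1)) (fun c => ordN (γ n c))
      (fun c => ordN (γ (n + 1) c)) (ordN (γ n (j n))) (hF1 n) (hexc n) (hF2 n) (hF3 n)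
      (htwo n) (htwo (n + 1))
    have h1 := hm1 n
    rw [hΨ, hΨ]
    beta_reduce at h
    omega
  have hdesc : ∀ n, Ψ n + n ≤ Ψ 0 := by
    intro n
    induction n with
    | zero => simp
    | succ n ih => have := hdrop n; omega
  have := hdesc (Ψ 0 + 1)
  omega

end ArcShedding

section Branch

/-- **`BranchSelection`** — LIBRARY TARGET (classical algebraic geometry over a field; not yet in Mathlib; unproved in
kernel here).  DATA: a point-blowup chain `G_{n+1} = translate b_n (chartTransform s j_n G_n)` in `𝔸³_K` with
`ord G_n = s` at the centres, whose EXCEPTIONAL PLANE `{y_{j_n} = 0}` meets the order-`s` locus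
`S_{n+1} = V(multIdeal s G_{n+1})` only at the centre (certificate form), and whose order-`s` loci are NOT isolated at
the centres for infinitely many `n`.  CONCLUSION: over some field `L ⊇ K` there is a COMPATIBLE FAMILY OF FORMAL ARCS
`γ⁽ⁿ⁾ : Fin 3 → L⟦τ⟧` through the centres (`γ⁽ⁿ⁾(0) = 0`, `γ⁽ⁿ⁾ ≠ 0`, `γ⁽ⁿ⁾ = σₙ ∘ γ⁽ⁿ⁺¹⁾` in the chart
`y_{j} = y'_{j}`, `y_i = y'_{j}·(y'_i + b_i)`), each annihilating `multIdeal s G_n`.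
PROOF ON PAPER (all classical): (1) `V(multIdeal s G)(K̄)` is the locus of points of multiplicity `≥ s` of `G`
(Hasse–Schmidt criterion, Kawanoue–Matsuki arXiv:math/0607009 Lemma 1.2.3.1), so off the exceptional plane the chart map
identifies `S_{n+1} ∖ E` with `S_n ∖ {0}` near the centres; hence isolation at stage `n` plus the exceptional certificate
gives isolation at stage `n + 1`, and «not isolated infinitely often» is «never isolated»; (2) by the exceptional
certificate no component of `S_n` through the centre lies in `E_n` and (a surface through the centre would meet `E_n` in a
curve) `S_n` is near the centre a finite union of irreducible CURVES (`n ≥ 1`); (3) the set `B_n` of branches of `S_1` at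
the centre (points of the normalisation over it — finitely many) whose successive strict transforms pass through the
centres up to stage `n` is non-empty (a curve component of `S_n` through the centre is the strict transform of one of
`S_{n-1}`), finite and decreasing, so some branch `β ∈ ⋂ B_n` is followed for ever (König for finite sets); (4) the
completed local ring of the normalisation at `β` is `K̄⟦τ⟧` (Cohen; smooth curve germ over an algebraically closed field),
the coordinate functions of the strict transforms give the arcs `γ⁽ⁿ⁾` (`n ≥ 1`; `γ⁽⁰⁾ := σ₀ ∘ γ⁽¹⁾`), non-zero because a
curve has a non-constant coordinate and `𝒪_C → K̄⟦τ⟧` is injective, with zero constant terms because the branch passes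
through the centres, related by the chart formulas because the centre `x_{n+1}` is the tangent direction of `β_n`, and
killed by `multIdeal s G_n ⊆ I(S_n) ⊆ I(β_n)`.  [new; library target — Hartshorne I Ex. 3.x/II 6.x (curves, normalisation),
Cohen structure theorem, arXiv:math/0607009 Lemma 1.2.3.1] -/
def BranchSelection : Prop :=
  ∀ (K : Type) [Field K] (s : ℕ), 2 ≤ s →
    ∀ (G : ℕ → MvPolynomial (Fin 3) K) (j : ℕ → Fin 3) (b : ℕ → Fin 3 → K),
      (∀ n, b n (j n) = 0) →
      (∀ n, G (n + 1) = translate (b n) (chartTransform s (j n) (G n))) →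
      (∀ n, ordZero (G n) = (s : ℕ∞)) →
      (∀ n, ∃ (M : ℕ) (g : MvPolynomial (Fin 3) K), constantCoeff g ≠ 0 ∧
        ∀ i, g * X i ^ M ∈ multIdeal s (G (n + 1)) ⊔ Ideal.span {X (j n)}) →
      (∀ m₀ : ℕ, ∃ n, m₀ ≤ n ∧ ¬ IsolatedMult s (G n)) →
      ∃ (L : Type) (_ : Field L) (_ : Algebra K L) (γ : ℕ → Fin 3 → PowerSeries L),
        (∀ n i, PowerSeries.constantCoeff (γ n i) = 0) ∧
        (∀ n, ∃ i, γ n i ≠ 0) ∧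
        (∀ n, γ n (j n) = γ (n + 1) (j n)) ∧
        (∀ n i, i ≠ j n → γ n i = γ n (j n) * (γ (n + 1) i + PowerSeries.C (algebraMap K L (b n i)))) ∧
        (∀ n, ∀ f ∈ multIdeal s (G n), MvPolynomial.aeval (γ n) f = 0)

/-- **`BranchSelection → ChainShedding`** (kernel): the wall certificates make every wall coordinate of the selected arcs
non-zero (evaluate `g · y_i^M ∈ multIdeal + (y_c)` along the arc: `g(γ)` is a unit), and `arc_shedding` finishes.
[new; composition] [folklore] -/
theorem chainShedding_of_branchSelection (hB : BranchSelection) : ChainShedding := by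
  intro K _ s hs G j b wall hbj hrec hnear htwo hexc hkept hiso
  by_contra hnot
  push Not at hnot
  obtain ⟨L, _instL, _instA, γ, h0, hnz, hj', hi', hann⟩ :=
    hB K s hs G j b hbj hrec hnear (fun n => hiso (n + 1) (j n) (hexc n)) hnot
  have hne : ∀ n c, wall n c → γ n c ≠ 0 := by
    intro n c hw hzero
    obtain ⟨M, g, hg, hmem⟩ := hiso n c hw
    obtain ⟨i, hi0⟩ := hnz n
    have heval : MvPolynomial.aeval (γ n) (g * X i ^ M) = 0 := by
      obtain ⟨u, hu, v, hv, huv⟩ := Submodule.mem_sup.mp (hmem i)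
      obtain ⟨w, rfl⟩ := Ideal.mem_span_singleton'.mp hv
      rw [← huv, map_add, hann n u hu, zero_add, map_mul, MvPolynomial.aeval_X, hzero, mul_zero]
    rw [map_mul, map_pow, MvPolynomial.aeval_X] at heval
    have hgc : PowerSeries.constantCoeff (MvPolynomial.aeval (γ n) g) ≠ 0 := by
      rw [MvPolynomial.map_aeval]
      have hz : (fun k => PowerSeries.constantCoeff (γ n k)) = 0 := funext fun k => h0 n k
      rw [hz, MvPolynomial.eval₂Hom_zero_apply, RingHom.comp_apply, PowerSeries.algebraMap_apply,
        PowerSeries.constantCoeff_C]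
      exact fun h => hg ((algebraMap K L).injective (by rw [h, map_zero]))
    rcases mul_eq_zero.mp heval with h | h
    · exact hgc (by rw [h, map_zero])
    · exact hi0 (pow_eq_zero_iff'.mp h).1
  exact arc_shedding γ j (fun n i => algebraMap K L (b n i)) wall h0 hj' hi' hne htwo hexc
    (fun n c hw hc => ⟨(hkept n c hw hc).1, by rw [(hkept n c hw hc).2, map_zero]⟩)

end Branch

end Summit.ResolutionOfSingularities.ResolutionOfSingularities.Theorems.NearCut
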